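import Summits.BirchSwinnertonDyer.BirchSwinnertonDyer.Theorems.RamifiedHeegnerPairLeafRankZeroUpperAtThreeShimuraInertSupply
import HarnessLib

/-!
# Route `RamifiedHeegnerPair`, crux U₀ `LeafRankZeroUpperAtThree` (stmt-BirchSwinnertonDyer-26024), line `splitkolyvagin0` —
# the INERT-CARRIER (Shimura-curve) road for U₀, part 5: the TWIST-UNIT certificate shape TU₀|inert (no L₁), the ρ̄₃-ONTO rows from
# the printed Heegner-system PRIMITIVES (no JSW flag), and the QUOTABLE two-carrier forms

HONEST FRAMING. Theorems only; helper file (`--supports stmt-BirchSwinnertonDyer-26024 --as helper`); nothing is booked, no item is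
closed, BSD is not proved for any curve; CONDITIONAL on every displayed input. Lead prover bsd-line-rhp-p2 g10, 2026-08-28.
The U₁ twins are `leafRankOneUpper_three_of_shimuraInertDatum_of_twistUnit` (part 5 of the U₁ files),
`leafRankOneUpper_three_of_twoCarriers_of_lowerRankZero[_of_primitives]` (parts 6, 8).

* `leafRankZeroUpper_three_of_shimuraInertDatum_of_twistUnitZero` — **the per-curve CERTIFICATE SHAPE TU₀|inert**: U₀ at a leaf curve
  (`r_an = 0`) on a Shimura row from the named facts {GZK, modularity ×2, JL, Pasten §6 CO, CST14+JSW17 on `X_{N⁺,N⁻}`} and ONE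
  Jetchev–Skinner–Wan field `K` (the inert set `S` inert and unramified, every other bad prime split, `d_K` odd) whose twist has a SIMPLE
  zero and `ord₃ #Ш_an(W^{(d_K)}) ≤ 0` at a globally minimal model — NO L₁, NO Friedberg–Hoffstein. (The rank-one twist's `#Ш_an` is the
  Gross–Zagier quantity `L′/(Ω·Reg·∏c)·|tors|²`, computable from a generator: the census instrument for kit seats on the 51 r0 Shimura rows.)
* `leafRankZeroUpper_three_of_shimuraInert_of_lowerRankOne_of_primitives` — part 3's theorem on the `ρ̄₃`-ONTO rows with the Kolyvagin
  bound taken from cell bsd-stepL's KERNEL argument over the printed primitives (`shimuraHeegnerAt_of_primitives_of_surj`): inputs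
  {GZK, modularity ×2, JL, Pasten §6 CO, CST14 Thm 1.5 companion, Poitou–Tate (sum form), Cassels–Tate level inputs, Heegner-system
  primitives at `3`, FH simple-zero inert-split} ∧ L₁ — no Σ, no L₀, no JSW flag.
* `leafRankZeroUpper_three_of_twoCarriers_of_lowerRankOne`, `…_of_lowerRankOne_of_primitives` — the QUOTABLE forms: two distinct
  split-multiplicative carriers `q₁, q₂` with `q₂` odd, `q₂ ≢ 1 (mod 3)`, every other split-multiplicative prime with `3 ∤ ord Δ_min`, SHAPE.

References: [cite: JetchevSkinnerWan2017, §7.4.1–7.4.2, Thm. 4.4.1] [cite: CaiShuTian2014, Thm. 1.5] [cite: PastenShimura2024, §6, Lemma 6.18]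
[cite: FriedbergHoffstein1995, Thm. B] [cite: McCallumLMS1991, §1 Theorem (Kolyvagin)] [cite: GrossZagier1986, V.§2] [cite: Miller2011LMS, Def. 1.1].
-/

-- D-0017: single-problem summit, so `Summit.BirchSwinnertonDyer.BirchSwinnertonDyer.…` repeats a namespace BY DESIGN.
set_option linter.dupNamespace false
set_option autoImplicit false

noncomputable section

open scoped Classical NumberField

open WeierstrassCurve NumberField IsDedekindDomain Literature Literature.NumberTheory.EllipticCurves
  Rat.HeightOneSpectrum CongruenceSubgroup
  Literature.NumberTheory.EllipticCurves.ModularForms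
  Literature.NumberTheory.EllipticCurves.Rank1Residual
  Literature.NumberTheory.EllipticCurves.Rank1Residual.Typed
  Literature.NumberTheory.QuadraticFields.Quadratic
  Literature.NumberTheory.GaloisCohomology
  Literature.NumberTheory.Automorphic
  Summit.BirchSwinnertonDyer.Rank1Residual
  Summit.BirchSwinnertonDyer.Rank1Residual.Additive
  Summit.BirchSwinnertonDyer.Rank1Residual.X11b
  Summit.BirchSwinnertonDyer.Rank1Residual.X11b.Three
  Summit.BirchSwinnertonDyer.BirchSwinnertonDyer.Theses.RamifiedHeegnerPair
  Summit.BirchSwinnertonDyer.BirchSwinnertonDyer.Theorems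

namespace Summit.BirchSwinnertonDyer.BirchSwinnertonDyer.Theorems.LeafShimuraInert

/-! ## §U0.5.1 Local data of a JSW field at a leaf curve -/

/-- At a leaf curve (additive at `3`) with an inert set `S` of multiplicative primes and a field in which every bad prime outside `S`
splits: `3 ∉ S`, `3 ∣ N`, `3` splits (two primes above it), the Heegner hypothesis at level `3` holds, and every `ℓ ∈ S` is a prime
`ℓ ∥ N` inert and unramified. Bookkeeping shared by the variants below. [folklore] -/
theorem jswField_localData (W : WeierstrassCurve ℚ) [W.IsElliptic] [W.IsGloballyMinimal] (hadd : Addv W 3)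
    (S : Finset ℕ) (hSmult : ∀ ℓ ∈ S, ∃ _ : Fact ℓ.Prime, W.HasMultiplicativeReductionAtPrime ℓ)
    (K : Type) [Field K] [NumberField K]
    (hinert : ∀ ℓ ∈ S, ((Ideal.span {(ℓ : ℤ)}).primesOver (𝓞 K)).ncard = 1 ∧ ¬ (ℓ : ℤ) ∣ NumberField.discr K)
    (hsplitN : ∀ ℓ : ℕ, ℓ.Prime → ℓ ∣ W.conductorNorm ℤ → ℓ ∉ S →
      ((Ideal.span {(ℓ : ℤ)}).primesOver (𝓞 K)).ncard = 2) :
    3 ∣ W.conductorNorm ℤ ∧ ((Ideal.span {((3 : ℕ) : ℤ)}).primesOver (𝓞 K)).ncard = 2 ∧ SatisfiesHeegnerHypothesis 3 K ∧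
      (∀ ℓ ∈ S, ℓ.Prime ∧ ℓ ∣ W.conductorNorm ℤ ∧ ¬ ℓ ^ 2 ∣ W.conductorNorm ℤ ∧
        ((Ideal.span {(ℓ : ℤ)}).primesOver (𝓞 K)).ncard = 1 ∧ ¬ (ℓ : ℤ) ∣ NumberField.discr K) := by
  have hp : (3 : ℕ).Prime := Nat.prime_three
  have hbad3 : ¬ W.HasGoodReductionAtPrime 3 := not_good_of_addv W 3 hadd
  have h3S : 3 ∉ S := by
    intro h
    obtain ⟨_, hm⟩ := hSmult 3 h
    exact not_mult_of_addv W 3 hadd hm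
  have h3N : 3 ∣ W.conductorNorm ℤ := (W.dvd_conductorNorm_iff_not_hasGoodReductionAtPrime 3).mpr hbad3
  have hps2 : ((Ideal.span {((3 : ℕ) : ℤ)}).primesOver (𝓞 K)).ncard = 2 := hsplitN 3 hp h3N h3S
  have hH3 : SatisfiesHeegnerHypothesis 3 K := fun q hq hq3 ↦ by
    have : q = 3 := (Nat.prime_dvd_prime_iff_eq hq hp).mp hq3
    subst this; exact hps2
  refine ⟨h3N, hps2, hH3, fun ℓ hℓ ↦ ?_⟩
  obtain ⟨hℓF, hm⟩ := hSmult ℓ hℓ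
  obtain ⟨hn, hd⟩ := hinert ℓ hℓ
  have hℓN : ℓ ∣ W.conductorNorm ℤ :=
    (W.dvd_conductorNorm_iff_not_hasGoodReductionAtPrime ℓ).mpr
      (WeierstrassCurve.HasMultiplicativeReduction.not_hasGoodReduction (R := ℤ_[ℓ]) hm)
  exact ⟨hℓF.out, hℓN, not_sq_dvd_conductorNorm_of_mult W ℓ hm, hn, hd⟩

/-! ## §U0.5.2 The twist-unit certificate shape TU₀|inert (no L₁, no Friedberg–Hoffstein) -/

/-- **U₀ AT A LEAF CURVE ON A SHIMURA ROW FROM ONE JSW FIELD WITH A TWIST-UNIT CERTIFICATE — TU₀|inert.** For `W/ℚ` globally minimal,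
additive of cell `(G) ∧ ss` at `3`, `r_an(W) = 0`, with a datum whose constant is a `3`-unit, an even inert set `S` of multiplicative primes
holding every split-multiplicative carrier, SHAPE, (DEG)-availability; ONE imaginary quadratic `K` of odd discriminant with `S` inert and
unramified and every other bad prime split, whose twist has a SIMPLE zero, and such that EVERY globally minimal model `Wd` of `W^{(d_K)}` has
`#Ш_an(Wd) = qd` with `ord₃ qd ≤ 0` (one model suffices in practice: `#Ш_an` is model-independent among globally minimal models — not used):
`Typed.MissingUpperBoundAt W 3` from {GZK, modularity ×2, JL, Pasten §6 CO, `shimuraCurve_heegnerPoint_grossZagier_kolyvagin`} — NO L₁,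
NO twist-supply fact. Proof: part 2's core with the Heegner datum from the named fact (U₁ part 8, Source 1) and the partner's lower half
read off the certificate (`missingLowerBoundAt_of_shaAn_padicValRat_le_zero`). CONDITIONAL; nothing booked; BSD is not proved.
[cite: JetchevSkinnerWan2017, §7.4.1, Thm. 4.4.1] [cite: CaiShuTian2014, Thm. 1.5] [cite: PastenShimura2024, §6] [cite: GrossZagier1986, V.§2] -/
theorem leafRankZeroUpper_three_of_shimuraInertDatum_of_twistUnitZero
    -- published inputs (named facts of the tree)
    (hGZK : rank_eq_analyticRank_of_analyticRank_le_one) (hmod : hasEntireLFunction_rat)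
    (hnf : exists_isNewformOf) (hJL : nonempty_shimuraParametrizationData)
    (hCO : PastenShimura2024_componentOrders)
    (hHK : shimuraCurve_heegnerPoint_grossZagier_kolyvagin)
    -- the leaf curve (`r_an = 0`), with a datum whose constant is a `3`-unit
    (W : WeierstrassCurve ℚ) [W.IsElliptic] [W.IsGloballyMinimal]
    (hadd : Addv W 3) (hsub : SubGss W 3) (hr : W.analyticRank = 0)
    {N : ℕ} [NeZero N] (hN : W.conductorNorm ℤ = N)
    (Dt : ModularParametrizationData W N) (hc : ¬ (3 : ℤ) ∣ Dt.c)
    -- the inert set, SHAPE and (DEG)-availability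
    (S : Finset ℕ) (hSeven : Even S.card)
    (hSmult : ∀ ℓ ∈ S, ∃ _ : Fact ℓ.Prime, W.HasMultiplicativeReductionAtPrime ℓ)
    (hFC : ∀ (ℓ : ℕ) [Fact ℓ.Prime], ℓ ∉ S → W.HasSplitMultiplicativeReductionAtPrime ℓ →
      ¬ 3 ∣ padicValInt ℓ W.minimalDiscriminantInt)
    (hshape : ∀ (q : ℕ) [Fact q.Prime], 3 ∣ (W.baseChange ℚ_[q]).localTamagawaNumber ℤ_[q] →
      W.HasSplitMultiplicativeReductionAtPrime q)
    (hDEG : (∃ ℓ₀ ∈ S, ¬ 3 ∣ padicValInt ℓ₀ W.minimalDiscriminantInt) ∨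
      (∃ ℓ₀ t : ℕ, ∃ _ : Fact ℓ₀.Prime, ∃ _ : Fact t.Prime,
        W.HasMultiplicativeReductionAtPrime ℓ₀ ∧ W.HasMultiplicativeReductionAtPrime t ∧
        ℓ₀ ∉ S ∧ t ∉ S ∧ t ≠ ℓ₀ ∧ ¬ 3 ∣ padicValInt ℓ₀ W.minimalDiscriminantInt) ∨
      (∃ q₁ q₂ : ℕ, S = {q₁, q₂} ∧ q₁ ≠ q₂ ∧ q₂ ≠ 2 ∧ q₂ % 3 ≠ 1))
    -- ONE Jetchev–Skinner–Wan field datum with a TWIST-UNIT certificate at the rank-one twist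
    (K : Type) [Field K] [NumberField K] (hK : IsImaginaryQuadratic K) (hodd : Odd (NumberField.discr K))
    (hinert : ∀ ℓ ∈ S, ((Ideal.span {(ℓ : ℤ)}).primesOver (𝓞 K)).ncard = 1 ∧ ¬ (ℓ : ℤ) ∣ NumberField.discr K)
    (hsplitN : ∀ ℓ : ℕ, ℓ.Prime → ℓ ∣ W.conductorNorm ℤ → ℓ ∉ S →
      ((Ideal.span {(ℓ : ℤ)}).primesOver (𝓞 K)).ncard = 2)
    (hLt0 : (W.quadraticTwist (NumberField.discr K : ℚ)).entireLFunction 1 = 0)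
    (hLt1 : deriv (W.quadraticTwist (NumberField.discr K : ℚ)).entireLFunction 1 ≠ 0)
    (hTU : ∀ (Wd : WeierstrassCurve ℚ) [Wd.IsElliptic] [Wd.IsGloballyMinimal] (Cd : VariableChange ℚ),
      Cd • W.quadraticTwist (NumberField.discr K : ℚ) = Wd → ∃ qd : ℚ, shaAn Wd = (qd : ℂ) ∧ padicValRat 3 qd ≤ 0) :
    Typed.MissingUpperBoundAt W 3 := by
  haveI h3F : Fact (Nat.Prime 3) := ⟨Nat.prime_three⟩
  subst hN
  have hirr : W.HasIrreducibleModPGaloisRep 3 := Additive.irr_of_subGss_of_ne_two W 3 (by decide) hadd hsub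
  obtain ⟨-, hps2, -, hSin⟩ := jswField_localData W hadd S hSmult K hinert hsplitN
  exact leafRankZeroUpper_three_of_shimuraInertDatum_at hGZK hmod hnf hJL hCO W hadd hsub hr rfl Dt hc S hSeven hSmult hFC hshape
    hDEG K hK hodd hinert hsplitN hLt0 hLt1
    (shimuraHeegnerAt_of_fact W rfl K hK S hSeven hSin hsplitN hps2 Dt hHK hirr)
    (fun Wd _ _ Cd hWd ↦ missingLowerBoundAt_of_shaAn_padicValRat_le_zero Wd (hTU Wd Cd hWd))

/-! ## §U0.5.3 The ρ̄₃-ONTO rows from the printed primitives (no JSW flag) -/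

/-- **U₀ AT A LEAF CURVE WITH `ρ̄₃` ONTO, ON A «SHIMURA ROW», FROM PRINTED THEOREMS TAKEN BY NAME AND L₁ — no Σ, no L₀, no JSW flag.**
Part 3's `leafRankZeroUpper_three_of_shimuraInert_of_lowerRankOne` with the Kolyvagin bound on `X_{N⁺,N⁻}` from cell bsd-stepL's KERNEL
argument over the printed Heegner-system primitives (U₁ part 8, Source 2: `shimuraHeegnerAt_of_primitives_of_surj`) instead of the named fact
`shimuraCurve_heegnerPoint_grossZagier_kolyvagin` (flag JSW17-Thm441-Nekovar-primary). Inputs BY NAME: GZK, modularity (`hmod`, `hnf`),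
Jacquet–Langlands, Pasten 2024 §6 component orders, Cai–Shu–Tian Thm. 1.5 (printed companion), Poitou–Tate (sum form), Cassels–Tate level
inputs, the Heegner-system primitives at `3`, Friedberg–Hoffstein simple-zero inert-split; and the route member L₁ (DECIDING) for the rank-one
leaf twist. CONDITIONAL; nothing booked; BSD is not proved. [cite: McCallumLMS1991, §1 Theorem (Kolyvagin)] [cite: CaiShuTian2014, Thm. 1.5]
[cite: PastenShimura2024, §6] [cite: FriedbergHoffstein1995, Thm. B] [cite: Miller2011LMS, Def. 1.1] -/
theorem leafRankZeroUpper_three_of_shimuraInert_of_lowerRankOne_of_primitives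
    -- published inputs (named facts of the tree), all printed theorems
    (hGZK : rank_eq_analyticRank_of_analyticRank_le_one) (hmod : hasEntireLFunction_rat)
    (hnf : exists_isNewformOf) (hJL : nonempty_shimuraParametrizationData)
    (hCO : PastenShimura2024_componentOrders)
    (hGZ3 : shimuraCurve_heegnerPoint_grossZagier)
    (hPT : ∀ (L : Type) [Field L] [NumberField L], poitouTate_sum_localTatePairing_eq_zero L)
    (hCT : ∀ (L : Type) [Field L] [NumberField L], casselsTate_levelInputs L)
    (hPrim : shimuraCurve_heegnerSystem_primitivesAtThree)
    (hFH1 : friedbergHoffstein_exists_twist_simpleZero_inertAt_splitAt)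
    -- the route member L₁ BY NAME
    (hL1 : Summit.BirchSwinnertonDyer.BirchSwinnertonDyer.Theses.RamifiedHeegnerPair.Gss2LowerAtThreeRankOne)
    -- the leaf curve (`r_an = 0`, ρ̄₃ onto), with a datum whose constant is a `3`-unit
    (W : WeierstrassCurve ℚ) [W.IsElliptic] [W.IsGloballyMinimal]
    (hCM : ¬ W.HasCM) (hadd : Addv W 3) (hsub : SubGss W 3) (hr : W.analyticRank = 0) (hsurj : Surj W 3)
    {N : ℕ} [NeZero N] (hN : W.conductorNorm ℤ = N)
    (Dt : ModularParametrizationData W N) (hc : ¬ (3 : ℤ) ∣ Dt.c)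
    -- the inert set (nonempty), SHAPE and (DEG)-availability
    (S : Finset ℕ) (hSeven : Even S.card) (hSne : S.Nonempty)
    (hSmult : ∀ ℓ ∈ S, ∃ _ : Fact ℓ.Prime, W.HasMultiplicativeReductionAtPrime ℓ)
    (hFC : ∀ (ℓ : ℕ) [Fact ℓ.Prime], ℓ ∉ S → W.HasSplitMultiplicativeReductionAtPrime ℓ →
      ¬ 3 ∣ padicValInt ℓ W.minimalDiscriminantInt)
    (hshape : ∀ (q : ℕ) [Fact q.Prime], 3 ∣ (W.baseChange ℚ_[q]).localTamagawaNumber ℤ_[q] →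
      W.HasSplitMultiplicativeReductionAtPrime q)
    (hDEG : (∃ ℓ₀ ∈ S, ¬ 3 ∣ padicValInt ℓ₀ W.minimalDiscriminantInt) ∨
      (∃ ℓ₀ t : ℕ, ∃ _ : Fact ℓ₀.Prime, ∃ _ : Fact t.Prime,
        W.HasMultiplicativeReductionAtPrime ℓ₀ ∧ W.HasMultiplicativeReductionAtPrime t ∧
        ℓ₀ ∉ S ∧ t ∉ S ∧ t ≠ ℓ₀ ∧ ¬ 3 ∣ padicValInt ℓ₀ W.minimalDiscriminantInt) ∨
      (∃ q₁ q₂ : ℕ, S = {q₁, q₂} ∧ q₁ ≠ q₂ ∧ q₂ ≠ 2 ∧ q₂ % 3 ≠ 1)) :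
    Typed.MissingUpperBoundAt W 3 := by
  haveI h3F : Fact (Nat.Prime 3) := ⟨Nat.prime_three⟩
  subst hN
  have hirr : W.HasIrreducibleModPGaloisRep 3 := Additive.irr_of_subGss_of_ne_two W 3 (by decide) hadd hsub
  -- the sign of the functional equation is `+1` (modularity, `r_an = 0`)
  have hw : W.rootNumber = 1 := by
    rw [WeierstrassCurve.rootNumber_eq_neg_one_pow_analyticRank_of_exists_isNewformOf hnf W, hr]
    norm_num
  -- a good prime (to be split in the field; any will do)
  obtain ⟨p₀, hp₀F, hgood₀⟩ := exists_goodPrime W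
  -- the field: `S` inert, every other bad prime split, `2` split when good, `p₀` split, the twist with a simple zero
  obtain ⟨K, _, _, hK, -, hinert, hsplitN, hsplit2, -, hLt0, hLt1⟩ := hFH1 W hw S hSmult hSeven hSne p₀ hgood₀ 4
  have hodd : Odd (NumberField.discr K) := by
    by_cases h2S : 2 ∈ S
    · obtain ⟨hn, hd⟩ := hinert 2 h2S
      exact odd_discr_of_two_inert_or_split hK.1
        (Or.inl ⟨by simpa only [Nat.cast_ofNat] using hn, by simpa only [Nat.cast_ofNat] using hd⟩)
    · by_cases h2N : 2 ∣ W.conductorNorm ℤ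
      · have hn := hsplitN 2 Nat.prime_two h2N h2S
        exact odd_discr_of_two_inert_or_split hK.1 (Or.inr (by simpa only [Nat.cast_ofNat] using hn))
      · exact odd_discr_of_two_inert_or_split hK.1 (Or.inr (hsplit2 h2N))
  obtain ⟨h3N, hps2, hH3, hSin⟩ := jswField_localData W hadd S hSmult K hinert hsplitN
  exact leafRankZeroUpper_three_of_shimuraInertDatum_at hGZK hmod hnf hJL hCO W hadd hsub hr rfl Dt hc S hSeven hSmult hFC hshape
    hDEG K hK hodd hinert hsplitN hLt0 hLt1
    (shimuraHeegnerAt_of_primitives_of_surj W rfl K hK S hSeven hSin hsplitN hps2 Dt hGZ3 hPT hGZK hmod hCT hPrim hsurj hirr h3N)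
    (fun Wd _ _ Cd hWd ↦ partnerLowerSplitThreeRankOne_of_lowerRankOne hmod hL1 W hCM hadd hsub K hK hodd hH3 hLt0 hLt1 Wd Cd hWd)

/-! ## §U0.5.4 The quotable two-carrier forms -/

/-- **U₀ AT A LEAF CURVE WITH TWO SPLIT-MULTIPLICATIVE CARRIERS, from named facts and L₁ — quotable form.** For `W/ℚ` globally minimal,
non-CM, additive of cell `(G) ∧ ss` at `3`, `r_an = 0`, carrying a datum with `3 ∤ c`; two distinct split-multiplicative primes `q₁, q₂`
with `q₂` odd, `q₂ ≢ 1 (mod 3)` (Papikian–Rabinoff / Pasten Lemma 6.18 gives (DEG)); every other split-multiplicative prime with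
`3 ∤ ord Δ_min`; SHAPE (every Tamagawa-`3` prime split multiplicative): `Typed.MissingUpperBoundAt W 3` from {GZK, modularity ×2, JL,
Pasten §6 CO, CST14+JSW17 on `X_{N⁺,N⁻}`, FH simple-zero inert-split} ∧ L₁. CONDITIONAL; nothing booked; BSD is not proved.
[cite: PastenShimura2024, Prop. 6.13, Lemma 6.18 (pp. 23–24)] [cite: JetchevSkinnerWan2017, §7.4.1–7.4.2, Thm. 4.4.1] [cite: FriedbergHoffstein1995, Thm. B] -/
theorem leafRankZeroUpper_three_of_twoCarriers_of_lowerRankOne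
    -- published inputs (named facts of the tree)
    (hGZK : rank_eq_analyticRank_of_analyticRank_le_one) (hmod : hasEntireLFunction_rat)
    (hnf : exists_isNewformOf) (hJL : nonempty_shimuraParametrizationData)
    (hCO : PastenShimura2024_componentOrders)
    (hHK : shimuraCurve_heegnerPoint_grossZagier_kolyvagin)
    (hFH1 : friedbergHoffstein_exists_twist_simpleZero_inertAt_splitAt)
    -- the route member L₁ BY NAME
    (hL1 : Summit.BirchSwinnertonDyer.BirchSwinnertonDyer.Theses.RamifiedHeegnerPair.Gss2LowerAtThreeRankOne)
    -- the leaf curve (`r_an = 0`), with a datum whose constant is a `3`-unit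
    (W : WeierstrassCurve ℚ) [W.IsElliptic] [W.IsGloballyMinimal]
    (hCM : ¬ W.HasCM) (hadd : Addv W 3) (hsub : SubGss W 3) (hr : W.analyticRank = 0)
    {N : ℕ} [NeZero N] (hN : W.conductorNorm ℤ = N)
    (Dt : ModularParametrizationData W N) (hc : ¬ (3 : ℤ) ∣ Dt.c)
    -- the two carriers and the shape
    {q₁ q₂ : ℕ} [Fact q₁.Prime] [Fact q₂.Prime] (hne : q₁ ≠ q₂)
    (h₁ : W.HasSplitMultiplicativeReductionAtPrime q₁) (h₂ : W.HasSplitMultiplicativeReductionAtPrime q₂)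
    (hothers : ∀ (ℓ : ℕ) [Fact ℓ.Prime], ℓ ≠ q₁ → ℓ ≠ q₂ → W.HasSplitMultiplicativeReductionAtPrime ℓ →
      ¬ 3 ∣ padicValInt ℓ W.minimalDiscriminantInt)
    (hq₂2 : q₂ ≠ 2) (hq₂1 : q₂ % 3 ≠ 1)
    (hshape : ∀ (q : ℕ) [Fact q.Prime], 3 ∣ (W.baseChange ℚ_[q]).localTamagawaNumber ℤ_[q] →
      W.HasSplitMultiplicativeReductionAtPrime q) :
    Typed.MissingUpperBoundAt W 3 := by
  obtain ⟨hSeven, hSmult, hFC, hDEG⟩ := inertPair_data W hne h₁ h₂ hothers hq₂2 hq₂1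
  exact leafRankZeroUpper_three_of_shimuraInert_of_lowerRankOne hGZK hmod hnf hJL hCO hHK hFH1 hL1 W hCM hadd hsub hr hN Dt hc
    {q₁, q₂} hSeven ⟨q₁, by simp⟩ hSmult hFC hshape hDEG

/-- **U₀ AT A LEAF CURVE WITH `ρ̄₃` ONTO AND TWO SPLIT-MULTIPLICATIVE CARRIERS, from PRINTED THEOREMS taken by name and L₁ — quotable form,
no Σ, no L₀, no JSW flag.** As `leafRankZeroUpper_three_of_twoCarriers_of_lowerRankOne`, with `ρ̄_{E,3}` ONTO and the Kolyvagin bound from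
the printed primitives (§U0.5.3). CONDITIONAL; nothing booked; BSD is not proved. [cite: McCallumLMS1991, §1 Theorem (Kolyvagin)]
[cite: CaiShuTian2014, Thm. 1.5] [cite: PastenShimura2024, Lemma 6.18] [cite: FriedbergHoffstein1995, Thm. B] -/
theorem leafRankZeroUpper_three_of_twoCarriers_of_lowerRankOne_of_primitives
    -- published inputs (named facts of the tree), all printed theorems
    (hGZK : rank_eq_analyticRank_of_analyticRank_le_one) (hmod : hasEntireLFunction_rat)
    (hnf : exists_isNewformOf) (hJL : nonempty_shimuraParametrizationData)
    (hCO : PastenShimura2024_componentOrders)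
    (hGZ3 : shimuraCurve_heegnerPoint_grossZagier)
    (hPT : ∀ (L : Type) [Field L] [NumberField L], poitouTate_sum_localTatePairing_eq_zero L)
    (hCT : ∀ (L : Type) [Field L] [NumberField L], casselsTate_levelInputs L)
    (hPrim : shimuraCurve_heegnerSystem_primitivesAtThree)
    (hFH1 : friedbergHoffstein_exists_twist_simpleZero_inertAt_splitAt)
    -- the route member L₁ BY NAME
    (hL1 : Summit.BirchSwinnertonDyer.BirchSwinnertonDyer.Theses.RamifiedHeegnerPair.Gss2LowerAtThreeRankOne)
    -- the leaf curve (`r_an = 0`, ρ̄₃ onto), with a datum whose constant is a `3`-unit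
    (W : WeierstrassCurve ℚ) [W.IsElliptic] [W.IsGloballyMinimal]
    (hCM : ¬ W.HasCM) (hadd : Addv W 3) (hsub : SubGss W 3) (hr : W.analyticRank = 0) (hsurj : Surj W 3)
    {N : ℕ} [NeZero N] (hN : W.conductorNorm ℤ = N)
    (Dt : ModularParametrizationData W N) (hc : ¬ (3 : ℤ) ∣ Dt.c)
    -- the two carriers and the shape
    {q₁ q₂ : ℕ} [Fact q₁.Prime] [Fact q₂.Prime] (hne : q₁ ≠ q₂)
    (h₁ : W.HasSplitMultiplicativeReductionAtPrime q₁) (h₂ : W.HasSplitMultiplicativeReductionAtPrime q₂)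
    (hothers : ∀ (ℓ : ℕ) [Fact ℓ.Prime], ℓ ≠ q₁ → ℓ ≠ q₂ → W.HasSplitMultiplicativeReductionAtPrime ℓ →
      ¬ 3 ∣ padicValInt ℓ W.minimalDiscriminantInt)
    (hq₂2 : q₂ ≠ 2) (hq₂1 : q₂ % 3 ≠ 1)
    (hshape : ∀ (q : ℕ) [Fact q.Prime], 3 ∣ (W.baseChange ℚ_[q]).localTamagawaNumber ℤ_[q] →
      W.HasSplitMultiplicativeReductionAtPrime q) :
    Typed.MissingUpperBoundAt W 3 := by
  obtain ⟨hSeven, hSmult, hFC, hDEG⟩ := inertPair_data W hne h₁ h₂ hothers hq₂2 hq₂1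
  exact leafRankZeroUpper_three_of_shimuraInert_of_lowerRankOne_of_primitives hGZK hmod hnf hJL hCO hGZ3 hPT hCT hPrim hFH1 hL1 W
    hCM hadd hsub hr hsurj hN Dt hc {q₁, q₂} hSeven ⟨q₁, by simp⟩ hSmult hFC hshape hDEG

end Summit.BirchSwinnertonDyer.BirchSwinnertonDyer.Theorems.LeafShimuraInert

end
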